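import Summits.BirchSwinnertonDyer.Rank1Residual.Additive.DicyclicGrowthLawsThree
import HarnessLib

/-!
# EMERTON–POLLACK–WESTON `λ`-VARIATION AT ADDITIVE LEVEL `3` (o6-r1 GEN 3 (G3-15), ask A-O6-T3 (h)):
# the typed EVIDENCE conjecture `MazurTateLambdaCongruenceThree branch` with the finite-layer EPW
# local terms `e_ℓ^{(k)}(W) = m_ℓ(W)·3^{min(k, v₃(ℓ²−1)−1)}` as explicit arithmetic
# (cell `b2b-bsdres`, lane CLASS-CLOSURE, seat cc-typer-5 GEN 3 = O5/O6 typer of record; content =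
# o6-r1 GEN 3 `cells/o5o6/TARGETS.md` §O6 (G3-15), (G3-13); placement, dedup and Lean phrasing =
# class typer) — TYPED, EVIDENCE-LABELLED, NOTHING ASSERTED

HONEST FRAMING (cell `b2b-bsdres`, verbatim in every file): the goal of the cell is to DELETE the
COMBINATION-SHAPED residual classes of the Birch–Swinnerton-Dyer formula for ALL analytic-rank `≤ 1`
elliptic curves over `ℚ` — "full BSD formula for every rank `≤ 1` curve in class `C`" assembled
STRICTLY from published theorems — so that the rank-`≤ 1` remainder becomes exactly the
CONSTRUCTION-SHAPED classes, which are TYPED (missing-input `Prop`s), NOT attempted. This is not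
"finishing BSD". Lane CLASS-CLOSURE: census output is EVIDENCE / conjecture items with held-out
validation, never a Literature fact; no main conjecture inside any certificate; nothing is booked; no
mark of `RESIDUAL-MAP.md` moves. 0 named Literature facts here; ONE `@[conjecture]` EVIDENCE node,
parameterised by the (not yet frozen) "same branch" relation, plus decidable arithmetic.

## The printed antecedent (a THEOREM at `p ∤ N`, ordinary) and the census finding (EVIDENCE at `9 ∣ N`)

Emerton–Pollack–Weston, Invent. Math. 163 (2006), THEOREM 2 [corpus: paper-arxiv-math_0404484 p0002]:
"Fix `* ∈ {alg, an}` and assume that `μ^*(ρ̄) = 0`. Let `f₁, f₂ ∈ H(ρ̄)` lie on the branches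
`T(𝔞₁), T(𝔞₂)` respectively. Then `λ^*(f₁) − λ^*(f₂) = Σ_{ℓ ∣ N₁N₂} e_ℓ(𝔞₂) − e_ℓ(𝔞₁)`; here the
sum is over all primes dividing the tame level of `f₁` or `f₂` and `e_ℓ(𝔞_j)` is a certain explicit
non-negative invariant of the branch `T(𝔞_j)` and the prime `ℓ`" — with (§5.1, Lemma 5.1.5 and
(eq.) before it, p0030) `e_ℓ(𝔞, ω^i) = λ(E_ℓ(𝔞, ⟨ℓ⟩_i^{−1})) = Σ_{v ∣ ℓ} dim_k H¹(ℚ_{∞,v}, A_{f,i})[π]`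
= (number of primes of `ℚ_∞` above `ℓ`) × (multiplicity of `ω^{1−i}` among the Frobenius
eigen-characters of `(V_f)_{I_ℓ}`, by Greenberg–Vatsal; §3.3). Setting: `ρ̄` absolutely irreducible,
`p`-ORDINARY and `p`-distinguished, `p ∤` tame level; Pollack–Weston 2011 §§4–5 carry the mechanism to
`p`-non-ordinary `f` of level prime to `p` (`λ^±`). NOTHING is in print at level divisible by `p²`.

o6-r1 GEN 3 (G3-15) (EVIDENCE; pure python `gen3/tower/epw_pairs.py` d34c35b09383b514, table
`epw_pairs.tsv` 5b986c3e361ed9f0): among all rows with Mazur–Tate data at the ADDITIVE prime `3`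
(cc-eng-3 ENG-D 2 724 O6-FW rows `k = 2, 3`; the 184-class literature set `k ≤ 6`; 296 dicyclic rows
`k ≤ 5`), dropping globally reducible `ρ̄`, call `W ~ W′` congruent when `a_ℓ(W) ≡ a_ℓ(W′) (mod 3)`
at every good `ℓ ≤ 150` (different isogeny classes): 2 203 congruent pairs on 1 380 curves with the
SAME `3`-local class `(v₃N, v₃Δ, LocIrr)`. Transcribing EPW Thm 2 to the finite layer `k` at `p = 3`
(`e_ℓ^{(k)}(W) := m_ℓ(W)·3^{min(k, v₃(ℓ²−1)−1)}`, `3^{v₃(ℓ²−1)−1}` = the number of primes of `ℚ_∞`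
above `ℓ`, capped by `[ℚ_k : ℚ] = 3^k`; `m_ℓ(W)` = multiplicity of the eigenvalue `1` of `Frob_ℓ` on
the `ℓ`-Euler factor mod `3` — good `ℓ`: roots of `x² − a_ℓx + ℓ` over `𝔽₃` equal to `1`;
multiplicative: `[a_ℓ·ℓ ≡ 1 (3)]`; additive: `0` — INCLUDING `ℓ = 2` and `ℓ > 150`):
`λ(θ_k(W)) − λ(θ_k(W′)) = Σ_{ℓ ≠ 3, ℓ ∣ N N′} (e_ℓ^{(k)}(W′) − e_ℓ^{(k)}(W))` holds on **2 737 / 2 741**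
layer-pairs with `μ = 0` on both sides and `λ` unsaturated (`max λ + |pred| < 3^k − 1`) — `k = 2`:
435/436, `k = 3`: 2 193/2 196, `k = 4`: 43/43, `k = 5`: 39/39, `k = 6`: 27/27 — and on 1 109 of the 1 111
with a NON-ZERO predicted shift (`|pred| ≤ 5`). The 4 exceptions: two at the saturation edge
(363825bh1~bk1 `k = 3`, 460350dn1~eb1 `k = 2`) and the two pairs through 303048m1, where `ℓ = 61` has a
DOUBLE eigenvalue `1` (`m = 2`) — "flagged, not explained". Cross-class: `v₃N` does not enter
(`(2,3)~(3,3)`, `(2,9)~(3,9)`, `(3,5)~(4,4)`, `(3,11)~(4,10)`: residual `0` on every layer), while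
`(2,3)~(2,6)` and `(2,6)~(3,3)` have a geometric-plus-2-periodic residual (153c1 = 17a1 ⊗ χ₋₃: the
`(2,6)` rows are the `ω`-branch) — hence a "same branch" relation finer than the residual class, NOT
YET FROZEN by o6-r1 ("to be sharpened: the invariant is the 3-adic inertial type up to unramified
twist, not `v₃N`"). NOVELTY (o6-r1's searches: corpus hybrid "Iwasawa invariants congruent modular
forms supersingular", galaxy pdf "plus and minus Selmer groups and congruences|Iwasawa invariants of
congruent" → EPW 2006 (ordinary), PW 2011 §4–5 (`p ∤ N` supersingular), Kim 2009 (± Selmer), Hatley–Lei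
arXiv:1608.00257, arXiv:1912.08430 (semistable); nothing at additive `p`): grade VARIANT — the EPW/PW
mechanism observed where it is not in print (`p² ∣ N`, potentially supersingular, residually
irreducible, locally irreducible AND locally reducible rows alike: 2 614 of the layer-pairs are `LocIrr`
rows, so the signed constants `λ′/c` of T-O6-D are congruence invariants up to the EPW local terms).

## What is typed (typer's decisions)

* §1 decidable arithmetic in the tree's vocabulary: `epwMultiplicityThree W ℓ` (`m_ℓ`; NOTE the
  tree's `frobeniusTrace` at a multiplicative `ℓ` is `1 + a_ℓ`, so `a_ℓ = frobeniusTrace − 1` there,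
  `X11b/FrobeniusTraceMultiplicative.lean`), `epwLayerTermThree W ℓ k` (`e_ℓ^{(k)}`),
  `epwShiftThree W W′ k = Σ_{ℓ ∣ N_W N_{W′}, ℓ ≠ 3} (e_ℓ^{(k)}(W′) − e_ℓ^{(k)}(W))`, and o6-r1's v0
  branch key `branchKeyV0Three` (`(4,4) ↦ 5`, `(4,10) ↦ 11`, else `v₃Δ_min`) with `SameBranchV0Three`.
* §2 the EVIDENCE node `MazurTateLambdaCongruenceThree branch`, the branch relation a PARAMETER
  (as the tower interfaces of `O6/TowerInterfaces.lean` are): binders `Addv W 3`, `Addv W′ 3`,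
  `E[3] ≅ E′[3]` as Galois modules (the tree's phrasing of X11a/X9, `geomTorsion`), `ρ̄_{W,3}`
  irreducible, `branch W W′`; for integral models `Θ, Θ′` of `θ_k(W), θ_k(W′)` (`IsScaledMazurTateLift
  · k 0 ·`, the tree's `Ω⁺_f` normalisation) with `μ(Θ) = μ(Θ′) = 0`, UNSATURATED
  (`max(λ, λ′) + |shift| < 3^k − 1`), and — HONESTY CLAUSE — no prime `ℓ ∣ N N′` with `m_ℓ = 2` on either
  side (the double-eigenvalue case of 303048m1 is EXCLUDED until explained; EPW Prop. 5.2's case (3)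
  has two extra branches there): `λ(Θ) − λ(Θ′) = epwShiftThree W W′ k`. With these binders the node is
  consistent with every one of o6-r1's 2 741 layer-pairs. Census falsifier (o6-r1): any congruent
  same-branch pair with `μ = 0`, unsaturated `λ`, `m_ℓ ≤ 1`, and residual `≠ 0`; first computation:
  `epw_pairs.py` on the full O6-FW table at `k = 4` (cc-eng-3, ASK A-ENG3-3).

DEDUP RULING (typer of record, 2026-08-21T09:10Z, on o5-r1's 08:50Z "ONE law, two formulations —
your call"): ONE LAW — `λ`-transport along mod-`3` congruences at the additive prime `3` — in TWO typed
formulations, cross-referenced, neither a certificate input. (A) `O5.CongruenceTransportLawThree` (o5-r1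
T11, `O5/O5GrowthLaws.lean`) is the formulation OF RECORD ON O5b: both branches `ε = ±` (the odd branch
via `χ₋₃` / `mazurTateElementOddThree`), eventual in `n`, and local terms = `λ` of the EXPLICIT layer-`n`
Euler elements (`O5.eulerElementThree`, `O5.polyLamThree`) — binder-free and correct also at primes `ℓ`
split at layer `n` (`v₃(ℓ²−1) − 1 ≥ n`), where the honest layer `λ`-term is `0` (the Euler element is a
constant; its `3`-divisibility moves `μ`, not `λ`) whereas the closed form below says `m_ℓ·3^n`;
validated on a pre-registered fresh universe (C-A2c: 2 280 pairs, 12 221/12 221 (pair, branch, layer)).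
(B) THIS node is the formulation of record OFF O5b (the whole additive locus, in particular the O6 wild
rows where no O5 typing applies): `+` branch, every layer, closed-form terms under the `μ = 0` /
unsaturation / `m_ℓ ≤ 1` binders, which make the over-count at split primes immaterial except in a
doubly-degenerate configuration (both curves with a `3`-divisible constant Euler element at layer `k`)
met in no pair so far (o5-r1 instrument C-A2d). On O5b `+`-rows (A) and (B) agree at every pair-layer
met. Kernel bridge (A) ⟹ (B)|_{O5b,+}: prover items L-O56-λpoly (`O5.polyLamThree (mazurTateElement f 3
n) = lam Θ` for an integral model) and L-O56-euler (`O5.polyLamThree (O5.eulerElementThree W true ℓ n) =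
epwLayerTermThree W ℓ n` when `v₃(ℓ²−1) − 1 < n`).

References: [EmertonPollackWeston2006] Invent. Math. 163, Thm 2, §3.3, §5.1 Lemma 5.1.5 [corpus:
paper-arxiv-math_0404484 p0002, p0019, p0030]; [PollackWeston2011MT] Duke 156 §§4–5;
[GreenbergVatsal2000] §2 (local Euler factors in `Λ`); o6-r1 GEN 3 `cells/o5o6/TARGETS.md` §O6
(G3-13), (G3-15) and `HOME/b2b-bsdres-o6-r1/gen3/O6-GEN3.md` §§6–7.
-/

set_option autoImplicit false

noncomputable section

open scoped Classical MatrixGroups ModularForm NumberField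

open CongruenceSubgroup Polynomial WeierstrassCurve NumberField Literature.NumberTheory.EllipticCurves
  Literature.NumberTheory.EllipticCurves.ModularForms
  Literature.NumberTheory.EllipticCurves.Rank1Residual
  Literature.NumberTheory.EllipticCurves.Rank1Residual.Typed
  Summit.BirchSwinnertonDyer.Rank1Residual.X1.MuLambda

namespace Summit.BirchSwinnertonDyer.Rank1Residual.Additive

/-! ## §1 The finite-layer EPW local terms at `p = 3` (decidable arithmetic) -/

section LocalTerms

variable (W : WeierstrassCurve ℚ) [W.IsGloballyMinimal]

/-- **`m_ℓ(W)`, the multiplicity of the eigenvalue `1` of `Frob_ℓ` on the `ℓ`-Euler factor of `W`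
mod `3`** (`ℓ ≠ 3` prime): good `ℓ` — the number of roots equal to `1` of `x² − a_ℓ x + ℓ` over `𝔽₃`
(`[3 ∣ 1 − a_ℓ + ℓ]`, doubled when also `ℓ ≡ 1 (3)`, i.e. `x² − a_ℓx + ℓ ≡ (x − 1)²`); multiplicative
`ℓ` — `[a_ℓ·ℓ ≡ 1 (3)]` with `a_ℓ = ±1 = frobeniusTrace W ℓ − 1` (the tree's `frobeniusTrace` is
`1 + a_ℓ` at a multiplicative prime, `X11b.frobeniusTrace_eq_two_of_split` / `_eq_zero_of_nonsplit`);
additive `ℓ` — `0`. Equivalently (EPW §3.3 via Greenberg–Vatsal) the multiplicity of `ω` among the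
Frobenius eigen-characters of `(V_W)_{I_ℓ}` mod `3` (`αβ = ℓ`: `α ≡ ℓ ⟺ β ≡ 1`). o6-r1 (G3-15)'s `m_ℓ`.
[cite: EmertonPollackWeston2006, §3.3 and §5.1 Lemma 5.1.5 (arXiv:math/0404484 p. 19, 30)] -/
def epwMultiplicityThree (ℓ : ℕ) [Fact ℓ.Prime] : ℕ :=
  if Good W ℓ then
    (if (3 : ℤ) ∣ 1 - W.frobeniusTrace ℓ + ℓ then 1 else 0) +
      (if (3 : ℤ) ∣ 1 - W.frobeniusTrace ℓ + ℓ ∧ (3 : ℤ) ∣ (ℓ : ℤ) - 1 then 1 else 0)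
  else if Mult W ℓ then (if (3 : ℤ) ∣ (W.frobeniusTrace ℓ - 1) * ℓ - 1 then 1 else 0)
  else 0

/-- `m_ℓ(W) ≤ 2`. [cite: EmertonPollackWeston2006, §5.2 (arXiv:math/0404484 p. 25: "0 ≤ e_ℓ ≤ 2")] -/
theorem epwMultiplicityThree_le_two (ℓ : ℕ) [Fact ℓ.Prime] : epwMultiplicityThree W ℓ ≤ 2 := by
  unfold epwMultiplicityThree
  split_ifs <;> omega

/-- **`e_ℓ^{(k)}(W) := m_ℓ(W) · 3^{min(k, v₃(ℓ² − 1) − 1)}`** — EPW's `e_ℓ = λ(E_ℓ(𝔞, ⟨ℓ⟩^{−1}))`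
`= m_ℓ ·` (number of primes of `ℚ_∞` above `ℓ` `= 3^{v₃(ℓ²−1)−1}`), read at the finite layer `ℚ_k`
(`[ℚ_k : ℚ] = 3^k` caps the number of primes above `ℓ`). o6-r1 (G3-15)'s transcription. CAVEAT (o5-r1
08:50Z): at a prime `ℓ` split at layer `k` (`v₃(ℓ²−1) − 1 ≥ k`) the layer-`k` Euler element is a
CONSTANT, so the honest `λ`-term is `0` (its `3`-divisibility is a `μ`-effect) — the exact term is
`λ(O5.eulerElementThree W true ℓ k)`; under the node's binders the difference is immaterial (see the
module docstring's DEDUP RULING). [cite: EmertonPollackWeston2006, Thm. 2 and §5.1 (arXiv:math/0404484 p. 2, 30)] -/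
def epwLayerTermThree (ℓ : ℕ) [Fact ℓ.Prime] (k : ℕ) : ℕ :=
  epwMultiplicityThree W ℓ * 3 ^ min k (padicValNat 3 (ℓ ^ 2 - 1) - 1)

variable (W' : WeierstrassCurve ℚ) [W'.IsGloballyMinimal]

/-- **The predicted shift `Σ_{ℓ ∣ N_W N_{W′}, ℓ ≠ 3} (e_ℓ^{(k)}(W′) − e_ℓ^{(k)}(W))`** (EPW Thm 2's right
hand side at the layer `k`; primes `ℓ ∤ 3 N_W N_{W′}` contribute equal terms on both sides of a mod-`3`
congruence and are omitted, as in print). [cite: EmertonPollackWeston2006, Thm. 2 (arXiv:math/0404484 p. 2)] -/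
def epwShiftThree (k : ℕ) : ℤ :=
  ∑ ℓ ∈ (W.conductorNorm ℤ * W'.conductorNorm ℤ).primeFactors.erase 3,
    if h : ℓ.Prime then
      (haveI : Fact ℓ.Prime := ⟨h⟩; ((epwLayerTermThree W' ℓ k : ℕ) : ℤ) - (epwLayerTermThree W ℓ k : ℕ))
    else 0

/-- **No double eigenvalue**: every prime `ℓ ≠ 3` of bad reduction for `W` or `W′` has `m_ℓ ≤ 1` on
both curves (excludes EPW Prop. 5.2 case (3) / o6-r1's two unexplained pairs through 303048m1,
`ℓ = 61`, `m = 2`). [folklore] -/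
def NoDoubleEigenvalueThree : Prop :=
  ∀ ℓ ∈ (W.conductorNorm ℤ * W'.conductorNorm ℤ).primeFactors.erase 3, ∀ (h : ℓ.Prime),
    (haveI : Fact ℓ.Prime := ⟨h⟩; epwMultiplicityThree W ℓ ≤ 1 ∧ epwMultiplicityThree W' ℓ ≤ 1)

end LocalTerms

section Branch

/-- **o6-r1's v0 branch key** (G3-15 "sameBranch := equal `v₃Δ` class in `{3, 6, 9, …}` mod the
`(3,5)~(4,4)`, `(3,11)~(4,10)` identifications"; `v₃N` does not enter): `(f₃, v₃Δ_min) = (4,4) ↦ 5`,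
`(4,10) ↦ 11`, otherwise `v₃Δ_min`. PROVISIONAL ("to be sharpened: the invariant is the 3-adic
inertial type up to unramified twist"). [folklore] -/
def branchKeyV0Three (f v : ℕ) : ℕ :=
  if f = 4 ∧ v = 4 then 5 else if f = 4 ∧ v = 10 then 11 else v

/-- `SameBranchV0Three W W′`: equal v0 branch keys of `(f₃, v₃Δ_min)`. [folklore] -/
def SameBranchV0Three (W W' : WeierstrassCurve ℚ) [W.IsElliptic] [W.IsGloballyMinimal] [W'.IsElliptic]
    [W'.IsGloballyMinimal] : Prop :=
  branchKeyV0Three (condExp W 3) (padicValInt 3 W.minimalDiscriminantInt) =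
    branchKeyV0Three (condExp W' 3) (padicValInt 3 W'.minimalDiscriminantInt)

/-- The identifications of the v0 key: `(3,5)~(4,4)`, `(3,11)~(4,10)`, and `(2,v)~(3,v)`. [folklore] -/
theorem branchKeyV0Three_examples :
    branchKeyV0Three 4 4 = branchKeyV0Three 3 5 ∧ branchKeyV0Three 4 10 = branchKeyV0Three 3 11 ∧
      branchKeyV0Three 2 3 = branchKeyV0Three 3 3 ∧ branchKeyV0Three 2 9 = branchKeyV0Three 3 9 ∧
      branchKeyV0Three 2 3 ≠ branchKeyV0Three 2 6 := by
  simp [branchKeyV0Three]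

end Branch


/-! ## §2 The EVIDENCE node (A-O6-T3 (h)) -/

section Law

/-- **`MazurTateLambdaCongruenceThree branch` — EMERTON–POLLACK–WESTON `λ`-VARIATION AT ADDITIVE LEVEL `3`
(CONJECTURE; EVIDENCE-labelled; o6-r1 GEN 3 (G3-15); the "same branch" relation is a PARAMETER, its v0
instance being `SameBranchV0Three`).** For `W, W′/ℚ` both ADDITIVE at `3`, with `E[3] ≅ E′[3]` as
`Γ_ℚ`-modules, `ρ̄_{W,3}` irreducible and `branch W W′`: at every layer `k ≥ 1`, for the integral models
`Θ, Θ′ ∈ Λ` of `θ_k(W), θ_k(W′)` in the tree's `Ω⁺_f` normalisation (`IsScaledMazurTateLift · k 0 ·`)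
with `μ(Θ) = μ(Θ′) = 0`, UNSATURATED (`max(λ(Θ), λ(Θ′)) + |shift| < 3^k − 1`, since `deg θ_k < 3^k`
caps `λ`) and with no double eigenvalue (`m_ℓ ≤ 1` at every `ℓ ∣ N N′`, `ℓ ≠ 3`):
**`λ(Θ) − λ(Θ′) = Σ_{ℓ ∣ N N′, ℓ ≠ 3} (e_ℓ^{(k)}(W′) − e_ℓ^{(k)}(W))`** (`epwShiftThree W W′ k`).
EVIDENCE (o6-r1, `gen3/tower/epw_pairs.tsv` 5b986c3e361ed9f0): 2 737/2 741 layer-pairs `k = 2..6`,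
1 109/1 111 with non-zero shift; the 4 exceptions are exactly the two saturation-edge pairs and the two
`m_{61} = 2` pairs excluded by the last two binders. Printed antecedent (a THEOREM in its own setting,
`p ∤ N`, ordinary): EPW Thm 2; `p ∤ N` non-ordinary: PW 2011 §§4–5. Nothing is in print at `9 ∣ N`;
this node asserts nothing and is consumed by nobody as a hypothesis of a certificate.
[cite: EmertonPollackWeston2006, Thm. 2 (arXiv:math/0404484 p. 2) and §5.1 Lemma 5.1.5 (p. 30)]
[cite: PollackWeston2011MT, §4–§5] -/
@[conjecture] def MazurTateLambdaCongruenceThree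
    (branch : WeierstrassCurve ℚ → WeierstrassCurve ℚ → Prop) : Prop :=
  ∀ (W W' : WeierstrassCurve ℚ) [W.IsElliptic] [W.IsGloballyMinimal] [NeZero (W.conductorNorm ℤ)]
    [W'.IsElliptic] [W'.IsGloballyMinimal] [NeZero (W'.conductorNorm ℤ)]
    (f : CuspForm (Gamma0 (W.conductorNorm ℤ)) 2) (f' : CuspForm (Gamma0 (W'.conductorNorm ℤ)) 2),
    IsNewformOf W f → IsNewformOf W' f' → Addv W 3 → Addv W' 3 →
    W.HasIrreducibleModPGaloisRep 3 →
    (∃ e : geomTorsion W (3 : ℤ) ≃+ geomTorsion W' (3 : ℤ),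
      ∀ (σ : Field.absoluteGaloisGroup ℚ) (P : geomTorsion W (3 : ℤ)), e (σ • P) = σ • e P) →
    branch W W' → NoDoubleEigenvalueThree W W' →
    ∀ (k : ℕ) (Θ Θ' : IwasawaAlgebra 3), 1 ≤ k →
      O5.IsScaledMazurTateLift f k 0 Θ → O5.IsScaledMazurTateLift f' k 0 Θ' → Θ ≠ 0 → Θ' ≠ 0 →
      mu Θ = 0 → mu Θ' = 0 →
      (max (lam Θ) (lam Θ') : ℤ) + |epwShiftThree W W' k| < 3 ^ k - 1 →
      (lam Θ : ℤ) - lam Θ' = epwShiftThree W W' k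

/-- **The v0 instance** (CONJECTURE; EVIDENCE-labelled; o6-r1's provisional branch relation):
`MazurTateLambdaCongruenceThree SameBranchV0Three` — the node the census of (G3-15) is scored against
(2 737/2 741; all 4 exceptions outside the binders). [cite: EmertonPollackWeston2006, Thm. 2 (arXiv:math/0404484 p. 2)] -/
@[conjecture] def MazurTateLambdaCongruenceV0Three : Prop :=
  MazurTateLambdaCongruenceThree
    (fun W W' ↦ ∀ [W.IsElliptic] [W.IsGloballyMinimal] [W'.IsElliptic] [W'.IsGloballyMinimal],
      SameBranchV0Three W W')

/-- Monotonicity in the branch relation: a law for a COARSER relation implies the law for any finer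
one (sharpening `sameBranch`, as o6-r1 intends, can only weaken the node). [folklore] -/
theorem MazurTateLambdaCongruenceThree.mono {branch branch' : WeierstrassCurve ℚ → WeierstrassCurve ℚ → Prop}
    (h : MazurTateLambdaCongruenceThree branch) (hle : ∀ W W', branch' W W' → branch W W') :
    MazurTateLambdaCongruenceThree branch' := by
  intro W W' _ _ _ _ _ _ f f' hf hf' hW hW' hirr hiso hb hnd k Θ Θ' hk hΘ hΘ' h0 h0' hμ hμ' hsat
  exact h W W' f f' hf hf' hW hW' hirr hiso (hle W W' hb) hnd k Θ Θ' hk hΘ hΘ' h0 h0' hμ hμ' hsat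

/-- **Congruence-invariance of `λ(θ_k)` when the local terms cancel** (the form in which (G3-13)'s
"rows sharing `(ρ̄, local class)` share `λ(θ_k)`" follows): under the node, if `epwShiftThree W W′ k = 0`
then `λ(Θ) = λ(Θ′)`. [folklore] -/
theorem lam_eq_of_mazurTateLambdaCongruence {branch : WeierstrassCurve ℚ → WeierstrassCurve ℚ → Prop}
    (h : MazurTateLambdaCongruenceThree branch)
    (W W' : WeierstrassCurve ℚ) [W.IsElliptic] [W.IsGloballyMinimal] [NeZero (W.conductorNorm ℤ)]
    [W'.IsElliptic] [W'.IsGloballyMinimal] [NeZero (W'.conductorNorm ℤ)]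
    (f : CuspForm (Gamma0 (W.conductorNorm ℤ)) 2) (f' : CuspForm (Gamma0 (W'.conductorNorm ℤ)) 2)
    (hf : IsNewformOf W f) (hf' : IsNewformOf W' f') (hW : Addv W 3) (hW' : Addv W' 3)
    (hirr : W.HasIrreducibleModPGaloisRep 3)
    (hiso : ∃ e : geomTorsion W (3 : ℤ) ≃+ geomTorsion W' (3 : ℤ),
      ∀ (σ : Field.absoluteGaloisGroup ℚ) (P : geomTorsion W (3 : ℤ)), e (σ • P) = σ • e P)
    (hb : branch W W') (hnd : NoDoubleEigenvalueThree W W') {k : ℕ} (hk : 1 ≤ k)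
    {Θ Θ' : IwasawaAlgebra 3} (hΘ : O5.IsScaledMazurTateLift f k 0 Θ)
    (hΘ' : O5.IsScaledMazurTateLift f' k 0 Θ') (h0 : Θ ≠ 0) (h0' : Θ' ≠ 0) (hμ : mu Θ = 0)
    (hμ' : mu Θ' = 0) (hshift : epwShiftThree W W' k = 0)
    (hsat : (max (lam Θ) (lam Θ') : ℤ) < 3 ^ k - 1) : lam Θ = lam Θ' := by
  have hsat' : (max (lam Θ) (lam Θ') : ℤ) + |epwShiftThree W W' k| < 3 ^ k - 1 := by
    rw [hshift, abs_zero, add_zero]; exact hsat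
  have := h W W' f f' hf hf' hW hW' hirr hiso hb hnd k Θ Θ' hk hΘ hΘ' h0 h0' hμ hμ' hsat'
  rw [hshift] at this
  omega

end Law

end Summit.BirchSwinnertonDyer.Rank1Residual.Additive

end
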